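import Literature.Computation.Certificates.BareissBlockPsd
import Literature.Computation.Certificates.PsdRoundedTwinGramL

/-!
# Bridge: a rational Gram block held as ROWS (`GramL.Q : List (List ℚ)`) → the zero-data
# fraction-free PSD decision `PSD.bzCheckC` (content-divisor Bareiss, `BareissBlockPsd.lean`)

Compute infrastructure (cell certnum, seat certnum-sdp-3; L4 PSD lanes). No named fact, no `sorry`.

THE PROBLEM IT REMOVES. gridfusion's SOS clients hold every Gram block as rational rows `…_Q` inside a
`SOS.GramL` record; the PSD side of a certificate is then supplied per block by certnum's rounded-twin
lanes (`PsdImplicitTwin`, `PsdRoundedTwin*`: a float seed, shipped factor columns, a packed DD check).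
gridfusion-lit-5's `PSD.bzCheckC` decides positive semidefiniteness of an INTEGER block presented by
its upper-triangle rows with NO auxiliary data, and — measured 2026-08-27 on principal sub-blocks of a
real 189-block Gram matrix, one farm node — costs 5.1 / 7.9 / 13.9 / 24.3 / 65.2 s at
`k = 28 / 40 / 48 / 60 / 84` against the implicit twin lane's 7.6 / 9.0 / 7.3 / 12.7 / 19.8 s
(certnum-sdp-3 kernel/crossover README, E-L4-psdlane-crossover-1): up to `k ≈ 40` it is the cheaper
lane in kernel seconds AND it ships nothing. This file lets a `GramL` block use it directly:
`PSD.upperOfRows d n Q` reads the integer upper rows of `d • Q` off the rational rows IN THE KERNEL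
(`d` = a common denominator named by the emitter; per entry one `Nat` division + one `Int` product — no
rational arithmetic), `PSD.upperOfRowsOK d n Q` checks `den(q_ij) ∣ d` and that the `n × n` window of
`Q` is symmetric, and
`SOS.GramL.quadNonneg_of_bareissC` concludes `g.toGramSOS.QuadNonneg ℝ` from the two Booleans and
`bzCheckC`. A singular PSD block (no rounded twin exists) is decided like any other.

* `PSD.upperOfRows`, `PSD.upperOfRowsOK` (structural `List.range` maps; `decide +kernel`-evaluable);
* `PSD.smul_matrixOfRows_eq_symOfUpper` — under the guard, `d • matrixOfRows n n Q = symOfUpper n U ᶻ↑`;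
* `PSD.posSemidef_matrixOfRows_map_of_bzCheckC` — PSD over `ℝ` of the cast block;
* `SOS.GramL.quadNonneg_of_posSemidef` — ANY real-PSD proof of the cast block gives `QuadNonneg ℝ`
  (generic entry point for field-valued lanes); `SOS.GramL.quadNonneg_of_bareissC` — the one-liner.

WHAT THIS FILE IS NOT: not a new decision procedure (the reader and its soundness are lit-5's
`BareissBlockPsd.lean`); not a completeness statement (a rejected block proves nothing); the guard is
part of the hypothesis — an emitter that names a `d` not clearing every denominator gets `false`.
-/

namespace Literature.Computation.Certificates

open Matrix

namespace PSD

/-- Integer UPPER rows of `d • Q` read off rational rows: row `i` lists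
`num(q_{i,i+t}) · (d / den(q_{i,i+t}))` for `t < n − i` — the integer `d · q` whenever `den(q) ∣ d`
(one `Nat` division and one `Int` product per entry; no rational arithmetic, no gcd). Meaningful under
`upperOfRowsOK`. [folklore] -/
def upperOfRows (d n : ℕ) (Q : List (List ℚ)) : List (List ℤ) :=
  (List.range n).map fun i => (List.range (n - i)).map fun t =>
    ((Q.getD i []).getD (i + t) 0).num * ((d / ((Q.getD i []).getD (i + t) 0).den : ℕ) : ℤ)

/-- Guard: on the `n × n` window, `den(q_ij) ∣ d` (so `d · q_ij` is an integer) and `q_ij = q_ji`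
(structural comparison of normalised rationals). [folklore] -/
def upperOfRowsOK (d n : ℕ) (Q : List (List ℚ)) : Bool :=
  (List.range n).all fun i => (List.range n).all fun j =>
    (d % ((Q.getD i []).getD j 0).den == 0) && ((Q.getD i []).getD j 0 == (Q.getD j []).getD i 0)

/-- `num(q) · (d / den(q)) = d · q` when `den(q) ∣ d`. [folklore] -/
private theorem num_mul_div_eq (q : ℚ) {d : ℕ} (h : q.den ∣ d) :
    ((q.num * ((d / q.den : ℕ) : ℤ) : ℤ) : ℚ) = (d : ℚ) * q := by
  obtain ⟨c, hc⟩ := h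
  subst hc
  rw [Nat.mul_div_cancel_left c q.den_pos]
  calc ((q.num * (c : ℕ) : ℤ) : ℚ) = (c : ℚ) * q.num := by push_cast; ring
    _ = (c : ℚ) * (q * q.den) := by rw [Rat.mul_den_eq_num]
    _ = ((q.den * c : ℕ) : ℚ) * q := by push_cast; ring

/-- Reading a mapped `List.range`. [folklore] -/
private theorem getD_map_range_rat {α : Type*} (f : ℕ → α) (n i : ℕ) (dflt : α) (hi : i < n) :
    ((List.range n).map f).getD i dflt = f i := by
  rw [List.getD_eq_getElem?_getD, List.getElem?_map, List.getElem?_range hi]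
  rfl

/-- What the guard says entrywise. [folklore] -/
private theorem of_upperOfRowsOK {d n : ℕ} {Q : List (List ℚ)} (h : upperOfRowsOK d n Q = true)
    (i j : Fin n) :
    ((Q.getD i.val []).getD j.val 0).den ∣ d ∧
      (Q.getD i.val []).getD j.val 0 = (Q.getD j.val []).getD i.val 0 := by
  unfold upperOfRowsOK at h
  have hi := List.all_eq_true.mp h i.val (List.mem_range.mpr i.isLt)
  have hij := List.all_eq_true.mp hi j.val (List.mem_range.mpr j.isLt)
  simp only [Bool.and_eq_true, beq_iff_eq] at hij
  exact ⟨Nat.dvd_of_mod_eq_zero hij.1, hij.2⟩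

/-- **The read integer block is `d • Q`**: under the guard, `symOfUpper n (upperOfRows d n Q)`, cast
to `ℚ`, equals `d • matrixOfRows n n Q` — the upper-triangle storage of a symmetric matrix recovers it.
[cite: BarrettEtAl1994, §4.3.1, p. 57] -/
theorem smul_matrixOfRows_eq_symOfUpper {d n : ℕ} {Q : List (List ℚ)} (h : upperOfRowsOK d n Q = true) :
    (d : ℚ) • matrixOfRows n n Q = (symOfUpper n (upperOfRows d n Q)).map (Int.cast : ℤ → ℚ) := by
  ext i j
  simp only [Matrix.smul_apply, Matrix.map_apply, matrixOfRows_apply, symOfUpper, upperOfRows, smul_eq_mul]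
  -- the entry of `d • Q` at `(a, b)` with `a ≤ b` is an integer equal to the read numerator
  have key : ∀ a b : Fin n, a.val ≤ b.val →
      ((((Q.getD a.val []).getD b.val 0).num * ((d / ((Q.getD a.val []).getD b.val 0).den : ℕ) : ℤ) : ℤ) : ℚ)
        = (d : ℚ) * ((Q.getD a.val []).getD b.val 0) := by
    intro a b _
    exact num_mul_div_eq _ (of_upperOfRowsOK h a b).1
  by_cases hij : i.val ≤ j.val
  · rw [if_pos hij, getD_map_range_rat _ _ _ _ i.isLt, getD_map_range_rat _ _ _ _ (by omega),
      show i.val + (j.val - i.val) = j.val by omega, key i j hij]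
  · rw [if_neg hij, getD_map_range_rat _ _ _ _ j.isLt, getD_map_range_rat _ _ _ _ (by omega),
      show j.val + (i.val - j.val) = i.val by omega, key j i (by omega), (of_upperOfRowsOK h i j).2]

/-- **PSD of a rational row block by the content-divisor Bareiss decision** (over `ℝ`).
[cite: CollowaldHubert2015, §4.1 Corollary 4.2] -/
theorem posSemidef_matrixOfRows_map_of_bzCheckC {d n : ℕ} {Q : List (List ℚ)} (hd : 0 < d)
    (hOK : upperOfRowsOK d n Q = true) (h : bzCheckC n (upperOfRows d n Q) = true) :
    ((matrixOfRows n n Q).map (Rat.cast : ℚ → ℝ)).PosSemidef := by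
  have hU := posSemidef_symOfUpper_of_bzCheckC h
  have e : (matrixOfRows n n Q).map (Rat.cast : ℚ → ℝ) =
      ((d : ℝ)⁻¹) • (symOfUpper n (upperOfRows d n Q)).map (Int.cast : ℤ → ℝ) := by
    have e1 := smul_matrixOfRows_eq_symOfUpper hOK
    have hd' : (d : ℝ) ≠ 0 := by exact_mod_cast hd.ne'
    ext i j
    have := congrFun (congrFun e1 i) j
    simp only [Matrix.smul_apply, Matrix.map_apply, smul_eq_mul] at this ⊢
    rw [← Rat.cast_intCast (α := ℝ), ← this]
    push_cast
    field_simp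
  rw [e]
  exact hU.smul (inv_nonneg.2 (by exact_mod_cast hd.le))

end PSD

namespace SOS

namespace GramL

/-- **Any real-PSD proof of the cast Gram block gives `QuadNonneg ℝ`** — the entry point for every
PSD lane that concludes `Matrix.PosSemidef` over `ℝ` (content-divisor Bareiss, rational `LDLᵀ`, …).
[cite: BlekhermanParriloThomas2012, Thm 3.39] -/
theorem quadNonneg_of_posSemidef (g : GramL)
    (h : ((matrixOfRows g.s g.s g.Q).map (Rat.cast : ℚ → ℝ)).PosSemidef) :
    g.toGramSOS.QuadNonneg ℝ := by
  refine g.quadNonneg_of_quadForm fun y => ?_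
  have hy := h.dotProduct_mulVec_nonneg y
  have e : star y ⬝ᵥ ((matrixOfRows g.s g.s g.Q).map (Rat.cast : ℚ → ℝ) *ᵥ y) =
      ∑ i, ∑ j, y i * ((matrixOfRows g.s g.s g.Q i j : ℚ) : ℝ) * y j := by
    simp only [dotProduct, mulVec, Matrix.map_apply, star_trivial, Finset.mul_sum]
    refine Finset.sum_congr rfl fun i _ => Finset.sum_congr rfl fun j _ => ?_
    ring
  rw [e] at hy
  exact hy

/-- **Zero-data PSD lane for a `GramL` block**: name a common denominator `d > 0`, decide the guard
`upperOfRowsOK d g.s g.Q` and `bzCheckC g.s (upperOfRows d g.s g.Q)`, conclude `QuadNonneg ℝ`.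
[cite: CollowaldHubert2015, §4.1 Corollary 4.2] -/
theorem quadNonneg_of_bareissC (g : GramL) {d : ℕ} (hd : 0 < d)
    (hOK : PSD.upperOfRowsOK d g.s g.Q = true)
    (h : PSD.bzCheckC g.s (PSD.upperOfRows d g.s g.Q) = true) : g.toGramSOS.QuadNonneg ℝ :=
  g.quadNonneg_of_posSemidef (PSD.posSemidef_matrixOfRows_map_of_bzCheckC hd hOK h)

/-- Test: the `2 × 2` block `[[1, -1/2], [-1/2, 1]]` with `d = 2` (integer block `[[2, -1], [-1, 2]]`). -/
example : (GramL.toGramSOS ⟨[[1, 0], [0, 1]], [[1, (-1 : ℚ)/2], [(-1 : ℚ)/2, 1]], [], []⟩).QuadNonneg ℝ :=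
  GramL.quadNonneg_of_bareissC _ (d := 2) (by decide) (by decide +kernel) (by decide +kernel)

end GramL

end SOS

end Literature.Computation.Certificates
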